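import Mathlib

/-!
# `HyperbolicEnd` (stmt-SmoothPoincare4-7825), line `Sketch`, negative side — the exponential rule

Helper for the native frozen-`J` refutation of the flat filling stub
(`Theorems/HyperbolicEnd/Negative/`). Statement registered on the crux item
(stub helper_frozen_expRule).

**The computation.** For a conformal factor `a = exp ∘ u` with `u` of class `C²` at `z` one has
`∇a = a ∇u` and `D²a[v, v] = a (D²u[v, v] + (Du v)²)`, hence `Δa = a (Δu + |∇u|²)` and
`a Δa - |∇a|² = a² Δu` exactly (the `|∇u|²` terms cancel).  The derivatives are computed along
the real lines `t ↦ z + t v`, `v = 1, I`: the slice of `exp ∘ u` is `exp` of the slice of `u`,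
with first derivative `u' e^u` and second derivative `(u'' + u'²) e^u` at `t = 0`
(`HasDerivAt.exp`), and `DΦ(z) v`, `D²Φ(z)[v, v]` are read off from this one-variable data
(`fderiv_iteratedFDeriv_of_line`, copied from `NeckDensity.lean`; the slice data for `u` is
copied from `NeckLineTest.lean`).  The Laplacians are `D²(·)[1, 1] + D²(·)[I, I]`
(`InnerProductSpace.laplacian_eq_iteratedFDeriv_complexPlane`).
-/

noncomputable section

-- the prescribed namespace `Summit.<P>.<Sub>.…` duplicates `SmoothPoincare4` (P = Sub)
set_option linter.dupNamespace false

open scoped ContDiff Topology Real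
open Laplacian Set Filter Metric Complex

namespace Summit.SmoothPoincare4.SmoothPoincare4.Theorems.HyperbolicEnd.Negative

/-! ### One-variable calculus along real lines in `ℂ` -/

/-- Derivative of `f : ℂ → F` along the real line `t ↦ z + t • v` at a parameter `t` where `f` is
differentiable (copied from `NeckLineTest.lean`). -/
private theorem hasDerivAt_line {F : Type*} [NormedAddCommGroup F] [NormedSpace ℝ F]
    {f : ℂ → F} (z v : ℂ) (t : ℝ) (hf : DifferentiableAt ℝ f (z + t • v)) :
    HasDerivAt (fun s : ℝ => f (z + s • v)) (fderiv ℝ f (z + t • v) v) t := by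
  have hl : HasDerivAt (fun s : ℝ => z + s • v) v t := by
    simpa using ((hasDerivAt_id t).smul_const v).const_add z
  exact hf.hasFDerivAt.comp_hasDerivAt t hl

/-- Second derivative along the line: for `f` of class `C²` at `z`, `t ↦ Df(z + t v) v` has
derivative `D²f(z)(v, v)` at `t = 0` (copied from `NeckLineTest.lean`). -/
private theorem hasDerivAt_line_fderiv {f : ℂ → ℝ} {z : ℂ} (hf : ContDiffAt ℝ 2 f z) (v : ℂ) :
    HasDerivAt (fun s : ℝ => fderiv ℝ f (z + s • v) v) (fderiv ℝ (fderiv ℝ f) z v v) 0 := by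
  have hD : DifferentiableAt ℝ (fderiv ℝ f) z :=
    (hf.fderiv_right (m := 1) (by norm_num)).differentiableAt one_ne_zero
  have hl : HasDerivAt (fun s : ℝ => z + s • v) v 0 := by
    simpa using ((hasDerivAt_id (0 : ℝ)).smul_const v).const_add z
  have hD' : HasFDerivAt (fderiv ℝ f) (fderiv ℝ (fderiv ℝ f) z) (z + (0 : ℝ) • v) := by
    rw [zero_smul, add_zero]
    exact hD.hasFDerivAt
  have h1 : HasDerivAt (fun s : ℝ => fderiv ℝ f (z + s • v)) (fderiv ℝ (fderiv ℝ f) z v) 0 :=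
    hD'.comp_hasDerivAt (0 : ℝ) hl
  have h2 := h1.clm_apply (hasDerivAt_const (0 : ℝ) v)
  simpa using h2

/-- A function of class `C²` at `z` is differentiable at the points `z + t v` for `t` near `0`
(copied from `NeckLineTest.lean`). -/
private theorem eventually_differentiableAt_line {f : ℂ → ℝ} {z : ℂ} (hf : ContDiffAt ℝ 2 f z)
    (v : ℂ) : ∀ᶠ t in 𝓝 (0 : ℝ), DifferentiableAt ℝ f (z + t • v) := by
  have hev : ∀ᶠ y in 𝓝 z, ContDiffAt ℝ 2 f y := hf.eventually (by simp)
  have hl : Continuous fun s : ℝ => z + s • v := by fun_prop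
  have ht : Tendsto (fun s : ℝ => z + s • v) (𝓝 0) (𝓝 z) := by
    simpa using hl.tendsto 0
  exact (ht.eventually hev).mono fun t ht => ht.differentiableAt two_ne_zero

/-- **Line lemma.** For a real function `f` on `ℂ`, `C²` at `z`, the directional derivatives
`Df(z) v` and `D²f(z)[v, v]` are the first and second derivatives at `0` of the slice
`t ↦ f (z + t v)`, read off from one-variable `HasDerivAt` data
(copied from `NeckDensity.lean`, with the line written as `z + t • v`). -/
private theorem fderiv_iteratedFDeriv_of_line {f : ℂ → ℝ} {z v : ℂ} (hf : ContDiffAt ℝ 2 f z)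
    {m₁ : ℝ → ℝ} {m₂ : ℝ}
    (h₁ : ∀ᶠ t in 𝓝 (0 : ℝ), HasDerivAt (fun s : ℝ => f (z + s • v)) (m₁ t) t)
    (h₂ : HasDerivAt m₁ m₂ 0) :
    fderiv ℝ f z v = m₁ 0 ∧ iteratedFDeriv ℝ 2 f z ![v, v] = m₂ := by
  -- the line through `z` in direction `v`
  set γ : ℝ → ℂ := fun t => z + t • v with hγ_def
  have hγ : ∀ t, HasDerivAt γ v t := fun t => by
    simpa [hγ_def] using ((hasDerivAt_id t).smul_const v).const_add z
  have hγ0 : γ 0 = z := by simp [hγ_def]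
  -- `f` is differentiable near `z`, `Df` is differentiable at `z`
  have hev : ∀ᶠ y in 𝓝 z, DifferentiableAt ℝ f y := by
    filter_upwards [hf.eventually (by simp)] with y hy
    exact hy.differentiableAt (by simp)
  have hD : DifferentiableAt ℝ (fderiv ℝ f) z :=
    (hf.fderiv_right (m := 1) (by norm_num)).differentiableAt one_ne_zero
  -- the slice and its first derivative near `0`
  have hφ' : ∀ᶠ t in 𝓝 (0 : ℝ), HasDerivAt (fun s : ℝ => f (z + s • v)) (fderiv ℝ f (γ t) v) t := by
    have : ∀ᶠ t in 𝓝 (0 : ℝ), DifferentiableAt ℝ f (γ t) := by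
      have hcont : ContinuousAt γ 0 := (hγ 0).continuousAt
      rw [← hγ0] at hev
      exact hcont.eventually hev
    filter_upwards [this] with t ht
    exact ht.hasFDerivAt.comp_hasDerivAt t (hγ t)
  -- so `m₁` agrees with `t ↦ Df(γ t) v` near `0`
  have hm₁ : m₁ =ᶠ[𝓝 0] fun t => fderiv ℝ f (γ t) v := by
    filter_upwards [h₁, hφ'] with t ht ht'
    exact ht.unique ht'
  refine ⟨?_, ?_⟩
  · have h0 := hm₁.eq_of_nhds
    simp only [hγ0] at h0
    exact h0.symm
  · -- second derivative of the slice at `0`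
    have h1 : HasDerivAt (fderiv ℝ f ∘ γ) (fderiv ℝ (fderiv ℝ f) (γ 0) v) 0 := by
      have hD' : DifferentiableAt ℝ (fderiv ℝ f) (γ 0) := by rw [hγ0]; exact hD
      exact hD'.hasFDerivAt.comp_hasDerivAt 0 (hγ 0)
    rw [hγ0] at h1
    have h2 := h1.clm_apply (hasDerivAt_const (0 : ℝ) v)
    simp only [ContinuousLinearMap.map_zero, add_zero, Function.comp_apply] at h2
    -- `h2 : HasDerivAt (fun t => fderiv ℝ f (γ t) v) (fderiv ℝ (fderiv ℝ f) z v v) 0`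
    have h3 : HasDerivAt m₁ (fderiv ℝ (fderiv ℝ f) z v v) 0 := h2.congr_of_eventuallyEq hm₁
    rw [iteratedFDeriv_two_apply]
    simpa using (h₂.unique h3).symm

/-! ### The exponential along a line -/

/-- **Direction lemma.** For `u` of class `C²` at `z` and `a = exp ∘ u`:
`Da(z) v = e^{u z} Du(z) v` and `D²a(z)[v, v] = e^{u z} (Du(z) v)² + e^{u z} D²u(z)[v, v]`,
read off from the slice `t ↦ exp (u (z + t v))`, whose derivatives are those of `exp` of the
slice of `u`. -/
private theorem exp_line {u : ℂ → ℝ} {z : ℂ} (hu : ContDiffAt ℝ 2 u z) (v : ℂ) :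
    fderiv ℝ (fun w => Real.exp (u w)) z v = Real.exp (u z) * fderiv ℝ u z v ∧
      iteratedFDeriv ℝ 2 (fun w => Real.exp (u w)) z ![v, v] =
        Real.exp (u z) * fderiv ℝ u z v * fderiv ℝ u z v +
          Real.exp (u z) * fderiv ℝ (fderiv ℝ u) z v v := by
  have hexp : ContDiffAt ℝ 2 (fun w => Real.exp (u w)) z :=
    Real.contDiff_exp.contDiffAt.comp z hu
  -- slice data for `u`
  have h1 : ∀ᶠ t in 𝓝 (0 : ℝ),
      HasDerivAt (fun s : ℝ => u (z + s • v)) (fderiv ℝ u (z + t • v) v) t :=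
    (eventually_differentiableAt_line hu v).mono fun t ht => hasDerivAt_line z v t ht
  have h10 : HasDerivAt (fun s : ℝ => u (z + s • v)) (fderiv ℝ u (z + (0 : ℝ) • v) v) 0 :=
    h1.self_of_nhds
  have h2 := hasDerivAt_line_fderiv hu v
  -- slice data for `exp ∘ u`
  have H1 : ∀ᶠ t in 𝓝 (0 : ℝ), HasDerivAt (fun s : ℝ => Real.exp (u (z + s • v)))
      (Real.exp (u (z + t • v)) * fderiv ℝ u (z + t • v) v) t :=
    h1.mono fun t ht => ht.exp
  have H2 := h10.exp.fun_mul h2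
  obtain ⟨e1, e2⟩ := fderiv_iteratedFDeriv_of_line (v := v) hexp H1 H2
  simp only [zero_smul, add_zero] at e1 e2
  exact ⟨e1, e2⟩

/-! ### The helper -/

/-- helper (T2, exponential rule): for a conformal factor `a = exp ∘ u` with `u` of class `C²`
at `z`, the curvature numerator satisfies `a Δa - |∇a|² = a² Δu` at `z`
(since `∇a = a ∇u` and `Δa = a (Δu + |∇u|²)`). -/
theorem helper_frozen_expRule : ∀ (u : ℂ → ℝ) (z : ℂ), ContDiffAt ℝ 2 u z →
    Real.exp (u z) * (Δ (fun w => Real.exp (u w))) z -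
      ((fderiv ℝ (fun w => Real.exp (u w)) z 1) ^ 2 +
        (fderiv ℝ (fun w => Real.exp (u w)) z Complex.I) ^ 2) =
      (Real.exp (u z)) ^ 2 * (Δ u) z := by
  intro u z hu
  obtain ⟨e1, e2⟩ := exp_line hu 1
  obtain ⟨f1, f2⟩ := exp_line hu Complex.I
  have hΔu : (Δ u) z =
      fderiv ℝ (fderiv ℝ u) z 1 1 + fderiv ℝ (fderiv ℝ u) z Complex.I Complex.I := by
    rw [InnerProductSpace.laplacian_eq_iteratedFDeriv_complexPlane u]
    simp [iteratedFDeriv_two_apply]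
  have hΔe : (Δ (fun w => Real.exp (u w))) z =
      iteratedFDeriv ℝ 2 (fun w => Real.exp (u w)) z ![1, 1] +
        iteratedFDeriv ℝ 2 (fun w => Real.exp (u w)) z ![Complex.I, Complex.I] := by
    rw [InnerProductSpace.laplacian_eq_iteratedFDeriv_complexPlane]
  rw [hΔu, hΔe, e1, e2, f1, f2]
  ring

end Summit.SmoothPoincare4.SmoothPoincare4.Theorems.HyperbolicEnd.Negative

end
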